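import Summits.CriticalPhenomena.Ising3DConformalLimit.Theorems.FKParityRobustnessSourceTrailsMeetRungs
import Summits.CriticalPhenomena.Ising3DConformalLimit.Theorems.FKParityRobustnessSourceTrailsMeetSquare
import HarnessLib

/-!
# `SourceTrailsMeet` (stmt-CriticalPhenomena-11255): the logical square closes, II —
# `SourceTrailsMeet ↔ ParityRobustMerging ∧ FKFourConnectivity ↔ LoopJoinBound`

Route `FKParityRobustness`, sub-problem `Ising3DConformalLimit`.  Assembly of the four arrows:
`ParityRobustMerging ∧ FKFourConnectivity → SourceTrailsMeet` and `LoopJoinBound → SourceTrailsMeet`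
(seat 0: `sourceTrailsMeet_of_parityRobustMerging_of_fkFourConnectivity`, `sourceTrailsMeet_of_loopJoinBound`),
`SourceTrailsMeet → FKFourConnectivity` (seat 0: `fkFourConnectivity_of_sourceTrailsMeet`),
`SourceTrailsMeet → ParityRobustMerging` and `SourceTrailsMeet → LoopJoinBound` (part I:
`parityRobustMerging_of_sourceTrailsMeet`, `loopJoinBound_of_sourceTrailsMeet`):

* `sourceTrailsMeet_iff_parityRobustMerging_and_fkFourConnectivity` : the item IS the conjunction of the
  two cruxes stmt-CriticalPhenomena-11253 ∧ stmt-CriticalPhenomena-11254 (`BLOB ∧ P4`);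
* `sourceTrailsMeet_iff_loopJoinBound` : the item IS the loop-side join bound `c·Z(A_l) ≤ Z(A_l; joined)`,
  i.e. `ℓ^{A_l}_N[F joins A_l] ≥ c` uniformly in `l` (the crux campaign's Monte-Carlo observable);
* `not_sourceTrailsMeet_of_not_fkFourConnectivity` : the second kill switch.

Theorem-only file.  References: G. Grimmett, S. Janson, arXiv:0709.3039, Thm 3.1 [GrimmettJanson2007];
J. L. Lebowitz, Comm. Math. Phys. 35 (1974) 87 [Lebowitz1974].
-/

noncomputable section

open MeasureTheory Finset SimpleGraph
open Literature.Probability.LatticeModels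
open Literature.Probability.Percolation
open Summit.CriticalPhenomena.Ising3DConformalLimit.Cruxes.ParityRobustMerging.PlaquetteXorSurgery

namespace Summit.CriticalPhenomena.Ising3DConformalLimit.Theorems

open scoped Classical

open Summit.CriticalPhenomena.Ising3DConformalLimit.Theses.FKParityRobustness

/-- **The item is the conjunction of the two cruxes**:
`SourceTrailsMeet ↔ ParityRobustMerging ∧ FKFourConnectivity` (items stmt-CriticalPhenomena-11253 and
-11254 of the route): `→` by `parityRobustMerging_of_sourceTrailsMeet` and
`fkFourConnectivity_of_sourceTrailsMeet`, `←` by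
`sourceTrailsMeet_of_parityRobustMerging_of_fkFourConnectivity`.  In particular a refutation of either
crux refutes the item. [cite: GrimmettJanson2007, Thm 3.1] -/
theorem sourceTrailsMeet_iff_parityRobustMerging_and_fkFourConnectivity :
    SourceTrailsMeet ↔ ParityRobustMerging ∧ FKFourConnectivity :=
  ⟨fun h => ⟨parityRobustMerging_of_sourceTrailsMeet h, fkFourConnectivity_of_sourceTrailsMeet h⟩,
    fun h => sourceTrailsMeet_of_parityRobustMerging_of_fkFourConnectivity h.1 h.2⟩

/-- **Kill switches of the item**: a refutation of the crux `FKFourConnectivity`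
(stmt-CriticalPhenomena-11254, FK four-point hyperscaling) refutes `SourceTrailsMeet` (contrapositive of
`fkFourConnectivity_of_sourceTrailsMeet`). [cite: GrimmettJanson2007, Thm 3.1] -/
theorem not_sourceTrailsMeet_of_not_fkFourConnectivity : ¬FKFourConnectivity → ¬SourceTrailsMeet :=
  fun hn hS => hn (fkFourConnectivity_of_sourceTrailsMeet hS)

/-- **`SourceTrailsMeet` IS the loop-side join bound**: the item holds iff for some `c > 0`, all
`l ≥ 1`, all large `N` and `a = l·tetra ⊂ Λ_N`, `c·Z(A) ≤ Z(A; all aᵢ in one component of F)`, i.e. iff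
the critical sourced loop-O(1) measure `ℓ^{A_l}_N` joins its four tetrahedral sources with probability
bounded below uniformly in `l` (`→`: `loopJoinBound_of_sourceTrailsMeet`, constant `c/3`; `←`: seat 0's
`sourceTrailsMeet_of_loopJoinBound`, Griffiths II in loop dress).  This is the Monte-Carlo observable
of the crux campaign on `ParityRobustMerging`. [cite: GrimmettJanson2007, Thm 3.1] -/
theorem sourceTrailsMeet_iff_loopJoinBound : SourceTrailsMeet ↔
    (let tetra : Fin 4 → Literature.Probability.LatticeModels.Site 3 := ![![-1, -1, -1], ![1, 1, -1], ![1, -1, 1], ![-1, 1, 1]]; ∃ c : ℝ, 0 < c ∧ ∀ l : ℕ, 1 ≤ l → ∃ N₀ : ℕ, ∀ N : ℕ, N₀ ≤ N → ∀ a : Fin 4 → ↥(Literature.Probability.LatticeModels.box 3 N), (∀ i, ((a i : Literature.Probability.LatticeModels.Site 3)) = (l : ℤ) • tetra i) → c * zMass ((Literature.Probability.LatticeModels.zdGraph 3).comap (Subtype.val : ↥(Literature.Probability.LatticeModels.box 3 N) → Literature.Probability.LatticeModels.Site 3)) (Real.tanh (Literature.Probability.LatticeModels.criticalBeta 3)) a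 (fun _ => True) ≤ zMass ((Literature.Probability.LatticeModels.zdGraph 3).comap (Subtype.val : ↥(Literature.Probability.LatticeModels.box 3 N) → Literature.Probability.LatticeModels.Site 3)) (Real.tanh (Literature.Probability.LatticeModels.criticalBeta 3)) a (fun F => JoinsAll a F)) :=
  ⟨loopJoinBound_of_sourceTrailsMeet, sourceTrailsMeet_of_loopJoinBound⟩

end Summit.CriticalPhenomena.Ising3DConformalLimit.Theorems

end
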